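import Summits.Ventures.CertifiedManyBodySolver.Observables.TISourcedMinimiserChordFloorExact
import Literature.MathematicalPhysics.QuantumLattice.DWaveSourceEnergyDensityEnsembles
import Literature.MathematicalPhysics.QuantumLattice.InfVolFermionStateWeakLimits
import Literature.MathematicalPhysics.QuantumLattice.DWaveSourceNNNHoppingOrderParameter
import Literature.MathematicalPhysics.QuantumLattice.DWaveOrderParameterProofs
import HarnessLib

/-!
# Field transport of certified pinning-field RESPONSE floors: a floor certified at field `h` holds at
# every field `h′ ≥ h` (and a ceiling certified at `h` holds at every `h′ ≤ h`) — the floor table of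
# record becomes a STEP CURVE in `h`

Cell hubbard-cq (rung CQ, CQ-TABLE §B1-U / §B1-U(A0) / §B1-U(P2,P3); row «h-chord transport nodes», seat
hubbard-cq-obsth-2). The cell's certified finite-field response floors are all statements of the shape
«for every state `ω` of a CLASS minimising the sourced mean energy
`E_h(ω) = ω.meanEnergy (hubbardTTPrimeSourcedInteraction t t′ U μ ĝ_d h) 1` at ONE field `h`,
`m ≤ Re ω(P₀^d)`», for three infinite-volume classes:

* CANONICAL class — translation-invariant states of a fixed density `n` (the B1-U leaves of record
  `Certificates.canonicalChordFloor_U8_n7o8_tp0_g…_of_nodes`, pin-1 p473547; the «3/14 ⊕ W5» leaf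
  `re_expect_localPairAt_ge_decimal_threeFourteenths_of_W5_mixed`, p476102; the A0 twins
  `…_tpm1o4_g…_capTP_decimal_of_nodes`, p6);
* GRAND-CANONICAL class — all translation-invariant states at chemical potential `μ`
  (`IsMeanEnergyMinimiser`; obsth-3's `gcTangentFloor473_…_tiMinimiser`, `gcChordFloorTL_…_tiMinimiser[_of_nodes]`),
  which contains every TORUS-LIMIT ground state (`IsTorusLimitOf.isMeanEnergyMinimiser_sourced`, p465872);
* the torus STAIR `liminf_L m_{L+1}(h)` (`…_liminf` leaves).

THE TRANSPORT NODE (Griffiths 1966 §II; Koma–Tasaki 1994 §1 — monotonicity of the conjugate density along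
minimisers of a concave family): if `ω₀` minimises `E_h` and `ω` minimises `E_{h′}` IN THE SAME CLASS and
`h < h′`, then `Re ω₀(P₀^d) ≤ Re ω(P₀^d)` (add the two variational inequalities `E_h(ω₀) ≤ E_h(ω)`,
`E_{h′}(ω) ≤ E_{h′}(ω₀)`; the `h`-independent parts cancel and `2(h′ − h)(Re ω(P) − Re ω₀(P)) ≥ 0`).
Since minimisers EXIST in each class at every field (`exists_minimiser_canonicalClass`, p2 p467969 on
Bratteli–Robinson I Thm. 2.3.15; `FermionInteraction.exists_isMeanEnergyMinimiser`, p5 p465890), a floor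
`m` valid for EVERY minimiser at `h` is valid for every minimiser at every `h′ ≥ h`
(`canonicalClass_responseFloor_of_le_field`, `gcClass_responseFloor_of_le_field`,
`torusLimit_responseFloor_of_le_field`), a CEILING valid for every minimiser at `h` is valid at every
`h′ ≤ h` (`…_responseCeiling_of_field_le`), and the stair floors transport by
`liminf_dWaveSourceDensity[TT']_mono`. No chord is recomputed and NO `h/h′` LOSS is incurred (re-reading the
certified cap row at the larger field would lose the factor `h/h′`).

CONSEQUENCE FOR THE TABLE OF RECORD (companion file `SourcedResponseFloorStepCurve.lean`, literal corollaries BY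
NAME, zero new certification): the certified floor at `(8, 7/8, t′)` becomes the running maximum of the landed leaves
— e.g. `t′ = 0` canonical: `0.0751899` on `h_tree ∈ [0.30305, 0.40406)` (so the U3-field leaf `0.0277821` at
`h_tree = 0.35355` is superseded), `0.0882348` on `[0.40406, 0.60609)`, `0.2452147` on `[0.60609, 0.80812)`,
`0.3422123` from `0.80812` on. This file is the GENERIC layer (real slots, any `t, t′, U, μ`, any floor / ceiling
value): §1 canonical class, §2 grand-canonical class + torus limits + stair.

HONEST FRAMING: transport lemmas on CONDITIONAL finite-field RESPONSE floors (each corollary carries exactly the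
claim nodes of the leaf it transports; CANDIDATE legs stay candidate); larger-field response floors are WEAKER
physics statements than smaller-field ones (the response is non-decreasing in `h`) — the transport never moves a
floor toward `h → 0⁺`, never yields an order parameter, never a phase word, not a superconductivity verdict.
Zero compute; no definition; no named fact; no `sorry`.
References: Griffiths, J. Math. Phys. 5 (1964) 1215 / Phys. Rev. 152 (1966) 240 §II; Koma–Tasaki,
J. Stat. Phys. 76 (1994) 745 §1; Bratteli–Robinson II (1997) Prop. 5.3.22 / I (1987) Thm. 2.3.15; Israel,
*Convexity in the theory of lattice gases* (1979) §I.3–II.1.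
-/

noncomputable section

namespace Summit.Ventures.CertifiedManyBodySolver.Observables

open Matrix Filter Finset Literature.Probability.LatticeModels
open Literature.MathematicalPhysics.QuantumLattice Literature.MathematicalPhysics.QuantumLattice.ThermodynamicLimit
open scoped ComplexOrder Topology

/-! ### §1 The canonical class (translation-invariant states of fixed density `n`) -/

section Canonical

variable {ω₀ ω : InfVolFermionState 2} {t t' U μ n m M h h' : ℝ}

/-- **Griffiths monotonicity in the canonical class.** If `ω₀` minimises `E_h` and `ω` minimises `E_{h′}` among
translation-invariant states of density `n`, and `h < h′`, then `Re ω₀(P₀^d) ≤ Re ω(P₀^d)`: the two variational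
inequalities `E_h(ω₀) ≤ E_h(ω)`, `E_{h′}(ω) ≤ E_{h′}(ω₀)` add up to `2(h′−h)(Re ω(P) − Re ω₀(P)) ≥ 0`.
[cite: Griffiths1966, §II] [cite: KomaTasaki1994, §1] -/
theorem re_expect_localPairAt_le_of_canonicalMinimisers (hω₀ : ω₀.IsTranslationInvariant)
    (hρ₀ : ω₀.density = n)
    (hmin₀ : ∀ ω' : InfVolFermionState 2, ω'.IsTranslationInvariant → ω'.density = n →
      ω₀.meanEnergy (hubbardTTPrimeSourcedInteraction t t' U μ dWaveFormFactor h) 1 ≤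
        ω'.meanEnergy (hubbardTTPrimeSourcedInteraction t t' U μ dWaveFormFactor h) 1)
    (hω : ω.IsTranslationInvariant) (hρ : ω.density = n)
    (hmin : ∀ ω' : InfVolFermionState 2, ω'.IsTranslationInvariant → ω'.density = n →
      ω.meanEnergy (hubbardTTPrimeSourcedInteraction t t' U μ dWaveFormFactor h') 1 ≤
        ω'.meanEnergy (hubbardTTPrimeSourcedInteraction t t' U μ dWaveFormFactor h') 1)
    (hlt : h < h') :
    (ω₀.expect (pairRegion (insert 0 unitSteps) 0) (localPairAt (insert 0 unitSteps) dWaveFormFactor 0)).re ≤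
      (ω.expect (pairRegion (insert 0 unitSteps) 0) (localPairAt (insert 0 unitSteps) dWaveFormFactor 0)).re := by
  have a := hmin₀ ω hω hρ
  have b := hmin ω₀ hω₀ hρ₀
  simp only [InfVolFermionState.meanEnergy_hubbardTTPrimeSourced,
    InfVolFermionState.meanEnergy_pairSourceInteraction_dWave_eq, hρ, hρ₀] at a b
  nlinarith [a, b, hlt]

/-- **FIELD TRANSPORT OF A CANONICAL-CLASS RESPONSE FLOOR.** If every translation-invariant density-`n` minimiser of
`E_h` has `m ≤ Re ω(P₀^d)` (`n ∈ [0,2)`) and `h ≤ h′`, then every translation-invariant density-`n` minimiser of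
`E_{h′}` has `m ≤ Re ω(P₀^d)` (minimisers at `h` exist, `exists_minimiser_canonicalClass`; then §1 monotonicity).
No `h/h′` loss. [cite: Griffiths1966, §II] [cite: KomaTasaki1994, §1] -/
theorem canonicalClass_responseFloor_of_le_field (hn0 : 0 ≤ n) (hn2 : n < 2) (hle : h ≤ h')
    (hfl : ∀ ω₀ : InfVolFermionState 2, ω₀.IsTranslationInvariant → ω₀.density = n →
      (∀ ω' : InfVolFermionState 2, ω'.IsTranslationInvariant → ω'.density = n →
        ω₀.meanEnergy (hubbardTTPrimeSourcedInteraction t t' U μ dWaveFormFactor h) 1 ≤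
          ω'.meanEnergy (hubbardTTPrimeSourcedInteraction t t' U μ dWaveFormFactor h) 1) →
      m ≤ (ω₀.expect (pairRegion (insert 0 unitSteps) 0)
        (localPairAt (insert 0 unitSteps) dWaveFormFactor 0)).re)
    (hω : ω.IsTranslationInvariant) (hρ : ω.density = n)
    (hmin : ∀ ω' : InfVolFermionState 2, ω'.IsTranslationInvariant → ω'.density = n →
      ω.meanEnergy (hubbardTTPrimeSourcedInteraction t t' U μ dWaveFormFactor h') 1 ≤
        ω'.meanEnergy (hubbardTTPrimeSourcedInteraction t t' U μ dWaveFormFactor h') 1) :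
    m ≤ (ω.expect (pairRegion (insert 0 unitSteps) 0) (localPairAt (insert 0 unitSteps) dWaveFormFactor 0)).re := by
  rcases hle.eq_or_lt with rfl | hlt
  · exact hfl ω hω hρ hmin
  · obtain ⟨ω₀, hω₀, hρ₀, hmin₀⟩ :=
      exists_minimiser_canonicalClass (hubbardTTPrimeSourcedInteraction t t' U μ dWaveFormFactor h) hn0 hn2
    exact (hfl ω₀ hω₀ hρ₀ hmin₀).trans
      (re_expect_localPairAt_le_of_canonicalMinimisers hω₀ hρ₀ hmin₀ hω hρ hmin hlt)

/-- **FIELD TRANSPORT OF A CANONICAL-CLASS RESPONSE CEILING** (the Koma–Tasaki direction): a ceiling `Re ω(P₀^d) ≤ M`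
valid for every translation-invariant density-`n` minimiser of `E_h` is valid for every such minimiser of `E_{h′}`,
`h′ ≤ h`. [cite: Griffiths1966, §II] [cite: KomaTasaki1994, §1] -/
theorem canonicalClass_responseCeiling_of_field_le (hn0 : 0 ≤ n) (hn2 : n < 2) (hle : h' ≤ h)
    (hcl : ∀ ω₀ : InfVolFermionState 2, ω₀.IsTranslationInvariant → ω₀.density = n →
      (∀ ω' : InfVolFermionState 2, ω'.IsTranslationInvariant → ω'.density = n →
        ω₀.meanEnergy (hubbardTTPrimeSourcedInteraction t t' U μ dWaveFormFactor h) 1 ≤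
          ω'.meanEnergy (hubbardTTPrimeSourcedInteraction t t' U μ dWaveFormFactor h) 1) →
      (ω₀.expect (pairRegion (insert 0 unitSteps) 0)
        (localPairAt (insert 0 unitSteps) dWaveFormFactor 0)).re ≤ M)
    (hω : ω.IsTranslationInvariant) (hρ : ω.density = n)
    (hmin : ∀ ω' : InfVolFermionState 2, ω'.IsTranslationInvariant → ω'.density = n →
      ω.meanEnergy (hubbardTTPrimeSourcedInteraction t t' U μ dWaveFormFactor h') 1 ≤
        ω'.meanEnergy (hubbardTTPrimeSourcedInteraction t t' U μ dWaveFormFactor h') 1) :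
    (ω.expect (pairRegion (insert 0 unitSteps) 0) (localPairAt (insert 0 unitSteps) dWaveFormFactor 0)).re ≤ M := by
  rcases hle.eq_or_lt with rfl | hlt
  · exact hcl ω hω hρ hmin
  · obtain ⟨ω₀, hω₀, hρ₀, hmin₀⟩ :=
      exists_minimiser_canonicalClass (hubbardTTPrimeSourcedInteraction t t' U μ dWaveFormFactor h) hn0 hn2
    exact (re_expect_localPairAt_le_of_canonicalMinimisers hω hρ hmin hω₀ hρ₀ hmin₀ hlt).trans
      (hcl ω₀ hω₀ hρ₀ hmin₀)

/-- **The «minimisers exist ∧ every minimiser obeys the floor» chain shape, transported**: the `(∃ ∧ ∀)` statement of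
the B1-U leaves (`minimiser_response_floor_…`) at field `h` implies the same statement at every field `h′ ≥ h`.
[cite: Griffiths1966, §II] [cite: BratteliRobinsonI1987, Thm. 2.3.15] -/
theorem canonicalClass_minimiser_response_floor_of_le_field (hn0 : 0 ≤ n) (hn2 : n < 2) (hle : h ≤ h')
    (hchain : (∃ ω : InfVolFermionState 2, ω.IsTranslationInvariant ∧ ω.density = n ∧
        ∀ ω' : InfVolFermionState 2, ω'.IsTranslationInvariant → ω'.density = n →
          ω.meanEnergy (hubbardTTPrimeSourcedInteraction t t' U μ dWaveFormFactor h) 1 ≤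
            ω'.meanEnergy (hubbardTTPrimeSourcedInteraction t t' U μ dWaveFormFactor h) 1) ∧
      ∀ ω : InfVolFermionState 2, ω.IsTranslationInvariant → ω.density = n →
        (∀ ω' : InfVolFermionState 2, ω'.IsTranslationInvariant → ω'.density = n →
          ω.meanEnergy (hubbardTTPrimeSourcedInteraction t t' U μ dWaveFormFactor h) 1 ≤
            ω'.meanEnergy (hubbardTTPrimeSourcedInteraction t t' U μ dWaveFormFactor h) 1) →
        m ≤ (ω.expect (pairRegion (insert 0 unitSteps) 0)
          (localPairAt (insert 0 unitSteps) dWaveFormFactor 0)).re) :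
    (∃ ω : InfVolFermionState 2, ω.IsTranslationInvariant ∧ ω.density = n ∧
        ∀ ω' : InfVolFermionState 2, ω'.IsTranslationInvariant → ω'.density = n →
          ω.meanEnergy (hubbardTTPrimeSourcedInteraction t t' U μ dWaveFormFactor h') 1 ≤
            ω'.meanEnergy (hubbardTTPrimeSourcedInteraction t t' U μ dWaveFormFactor h') 1) ∧
      ∀ ω : InfVolFermionState 2, ω.IsTranslationInvariant → ω.density = n →
        (∀ ω' : InfVolFermionState 2, ω'.IsTranslationInvariant → ω'.density = n →
          ω.meanEnergy (hubbardTTPrimeSourcedInteraction t t' U μ dWaveFormFactor h') 1 ≤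
            ω'.meanEnergy (hubbardTTPrimeSourcedInteraction t t' U μ dWaveFormFactor h') 1) →
        m ≤ (ω.expect (pairRegion (insert 0 unitSteps) 0)
          (localPairAt (insert 0 unitSteps) dWaveFormFactor 0)).re :=
  ⟨exists_minimiser_canonicalClass _ hn0 hn2, fun _ hω hρ hmin =>
    canonicalClass_responseFloor_of_le_field hn0 hn2 hle hchain.2 hω hρ hmin⟩

end Canonical

/-! ### §2 The grand-canonical class (all translation-invariant states at chemical potential `μ`), torus-limit
ground states, and the torus stair -/

section GrandCanonical

variable {ω₀ ω : InfVolFermionState 2} {t t' U μ m M h h' : ℝ}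
  {ψ : ∀ L, Fock (Orb (FermionTorus 2 L))} {Ls : ℕ → ℕ}

/-- **Griffiths monotonicity in the grand-canonical class, in the `Re ω(P₀^d)` dictionary** (the tree's
`IsMeanEnergyMinimiser.pairAmplitude_mono` with `e_P(ω) = 2 Re ω(P₀^d)`): `h < h′` ⇒ `Re ω₀(P₀^d) ≤ Re ω(P₀^d)` for a
minimiser `ω₀` at `h` and a minimiser `ω` at `h′`. [cite: KomaTasaki1994, §1] [cite: Griffiths1966, §II] -/
theorem re_expect_localPairAt_le_of_gcMinimisers
    (hmin₀ : ω₀.IsMeanEnergyMinimiser (hubbardTTPrimeSourcedInteraction t t' U μ dWaveFormFactor h) 1)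
    (hmin : ω.IsMeanEnergyMinimiser (hubbardTTPrimeSourcedInteraction t t' U μ dWaveFormFactor h') 1)
    (hlt : h < h') :
    (ω₀.expect (pairRegion (insert 0 unitSteps) 0) (localPairAt (insert 0 unitSteps) dWaveFormFactor 0)).re ≤
      (ω.expect (pairRegion (insert 0 unitSteps) 0) (localPairAt (insert 0 unitSteps) dWaveFormFactor 0)).re := by
  have hmono := hmin₀.pairAmplitude_mono hmin hlt
  rw [InfVolFermionState.meanEnergy_pairSourceInteraction_dWave_eq,
    InfVolFermionState.meanEnergy_pairSourceInteraction_dWave_eq] at hmono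
  linarith

/-- **FIELD TRANSPORT OF A GRAND-CANONICAL RESPONSE FLOOR**: a floor `m ≤ Re ω(P₀^d)` valid for EVERY
translation-invariant mean-energy minimiser of the sourced interaction at field `h` is valid for every minimiser at
every `h′ ≥ h` (minimisers at `h` exist: `FermionInteraction.exists_isMeanEnergyMinimiser`). No `h/h′` loss.
[cite: KomaTasaki1994, §1] [cite: BratteliKishimotoRobinson1978, Thm. 2] -/
theorem gcClass_responseFloor_of_le_field (hle : h ≤ h')
    (hfl : ∀ ω₀ : InfVolFermionState 2,
      ω₀.IsMeanEnergyMinimiser (hubbardTTPrimeSourcedInteraction t t' U μ dWaveFormFactor h) 1 →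
        m ≤ (ω₀.expect (pairRegion (insert 0 unitSteps) 0)
          (localPairAt (insert 0 unitSteps) dWaveFormFactor 0)).re)
    (hmin : ω.IsMeanEnergyMinimiser (hubbardTTPrimeSourcedInteraction t t' U μ dWaveFormFactor h') 1) :
    m ≤ (ω.expect (pairRegion (insert 0 unitSteps) 0) (localPairAt (insert 0 unitSteps) dWaveFormFactor 0)).re := by
  rcases hle.eq_or_lt with rfl | hlt
  · exact hfl ω hmin
  · obtain ⟨ω₀, hmin₀⟩ :=
      (hubbardTTPrimeSourcedInteraction t t' U μ dWaveFormFactor h).exists_isMeanEnergyMinimiser 1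
    exact (hfl ω₀ hmin₀).trans (re_expect_localPairAt_le_of_gcMinimisers hmin₀ hmin hlt)

/-- **FIELD TRANSPORT OF A GRAND-CANONICAL RESPONSE CEILING**: a ceiling valid for every minimiser at `h` is valid
for every minimiser at every `h′ ≤ h`. [cite: KomaTasaki1994, §1] [cite: BratteliKishimotoRobinson1978, Thm. 2] -/
theorem gcClass_responseCeiling_of_field_le (hle : h' ≤ h)
    (hcl : ∀ ω₀ : InfVolFermionState 2,
      ω₀.IsMeanEnergyMinimiser (hubbardTTPrimeSourcedInteraction t t' U μ dWaveFormFactor h) 1 →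
        (ω₀.expect (pairRegion (insert 0 unitSteps) 0)
          (localPairAt (insert 0 unitSteps) dWaveFormFactor 0)).re ≤ M)
    (hmin : ω.IsMeanEnergyMinimiser (hubbardTTPrimeSourcedInteraction t t' U μ dWaveFormFactor h') 1) :
    (ω.expect (pairRegion (insert 0 unitSteps) 0) (localPairAt (insert 0 unitSteps) dWaveFormFactor 0)).re ≤ M := by
  rcases hle.eq_or_lt with rfl | hlt
  · exact hcl ω hmin
  · obtain ⟨ω₀, hmin₀⟩ :=
      (hubbardTTPrimeSourcedInteraction t t' U μ dWaveFormFactor h).exists_isMeanEnergyMinimiser 1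
    exact (re_expect_localPairAt_le_of_gcMinimisers hmin hmin₀ hlt).trans (hcl ω₀ hmin₀)

/-- **TORUS-LIMIT ground states at the larger field inherit the grand-canonical floor**: a floor valid for every
translation-invariant GC minimiser at field `h` holds for every torus limit of unit ground-state vectors of
`dWaveSourceTorusTT' L t′ U μ h′` along any divergent side sequence, `h′ ≥ h` (torus limits of ground states are
GC minimisers, `IsTorusLimitOf.isMeanEnergyMinimiser_sourced`). [cite: BratteliKishimotoRobinson1978, Thm. 2] -/
theorem torusLimit_responseFloor_of_le_field [∀ j, NeZero (Ls j)] (hle : h ≤ h')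
    (hfl : ∀ ω₀ : InfVolFermionState 2,
      ω₀.IsMeanEnergyMinimiser (hubbardTTPrimeSourcedInteraction 1 t' U μ dWaveFormFactor h) 1 →
        m ≤ (ω₀.expect (pairRegion (insert 0 unitSteps) 0)
          (localPairAt (insert 0 unitSteps) dWaveFormFactor 0)).re)
    (hω : ω.IsTorusLimitOf ψ Ls) (hLs : Tendsto Ls atTop atTop) (hψ : ∀ j, star (ψ (Ls j)) ⬝ᵥ ψ (Ls j) = 1)
    (hgs : ∀ j, dWaveSourceTorusTT' (Ls j) t' U μ h' *ᵥ ψ (Ls j) =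
      ((Matrix.groundEnergy (dWaveSourceTorusTT' (Ls j) t' U μ h') : ℝ) : ℂ) • ψ (Ls j)) :
    m ≤ (ω.expect (pairRegion (insert 0 unitSteps) 0) (localPairAt (insert 0 unitSteps) dWaveFormFactor 0)).re :=
  gcClass_responseFloor_of_le_field hle hfl (hω.isMeanEnergyMinimiser_sourced hLs hψ t' U μ h' hgs)

/-- `t′ = 0` spelling of `torusLimit_responseFloor_of_le_field` with the tree's `dWaveSourceTorus`.
[cite: BratteliKishimotoRobinson1978, Thm. 2] -/
theorem torusLimit_responseFloor_of_le_field_tp0 [∀ j, NeZero (Ls j)] (hle : h ≤ h')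
    (hfl : ∀ ω₀ : InfVolFermionState 2,
      ω₀.IsMeanEnergyMinimiser (hubbardTTPrimeSourcedInteraction 1 0 U μ dWaveFormFactor h) 1 →
        m ≤ (ω₀.expect (pairRegion (insert 0 unitSteps) 0)
          (localPairAt (insert 0 unitSteps) dWaveFormFactor 0)).re)
    (hω : ω.IsTorusLimitOf ψ Ls) (hLs : Tendsto Ls atTop atTop) (hψ : ∀ j, star (ψ (Ls j)) ⬝ᵥ ψ (Ls j) = 1)
    (hgs : ∀ j, dWaveSourceTorus (Ls j) U μ h' *ᵥ ψ (Ls j) =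
      ((Matrix.groundEnergy (dWaveSourceTorus (Ls j) U μ h') : ℝ) : ℂ) • ψ (Ls j)) :
    m ≤ (ω.expect (pairRegion (insert 0 unitSteps) 0) (localPairAt (insert 0 unitSteps) dWaveFormFactor 0)).re :=
  torusLimit_responseFloor_of_le_field hle hfl hω hLs hψ (fun j => by
    simpa only [dWaveSourceTorusTT'_zero_tp] using hgs j)

/-- **The torus STAIR transports**: `m ≤ liminf_L m_{L+1}(h)` and `0 ≤ h ≤ h′` ⇒ `m ≤ liminf_L m_{L+1}(h′)`
(`liminf_dWaveSourceDensityTT'_mono`). [cite: KomaTasaki1994, §1] -/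
theorem stair_responseFloor_of_le_field (hh : 0 ≤ h) (hle : h ≤ h')
    (hfl : m ≤ liminf (fun L : ℕ => dWaveSourceDensityTT' (L + 1) t' U μ h) atTop) :
    m ≤ liminf (fun L : ℕ => dWaveSourceDensityTT' (L + 1) t' U μ h') atTop :=
  hfl.trans (liminf_dWaveSourceDensityTT'_mono t' U μ hh hle)

/-- `t′ = 0` spelling of `stair_responseFloor_of_le_field` (the tree's `dWaveSourceDensity`). [cite: KomaTasaki1994, §1] -/
theorem stair_responseFloor_of_le_field_tp0 (hh : 0 ≤ h) (hle : h ≤ h')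
    (hfl : m ≤ liminf (fun L : ℕ => dWaveSourceDensity (L + 1) U μ h) atTop) :
    m ≤ liminf (fun L : ℕ => dWaveSourceDensity (L + 1) U μ h') atTop :=
  hfl.trans (liminf_dWaveSourceDensity_mono U μ hh hle)

end GrandCanonical

end Summit.Ventures.CertifiedManyBodySolver.Observables

end
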